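import Literature.ComputerArithmetic.LangloisLouvet2006.CompHorner

/-!
# The compensated Horner scheme: the validated running error bound `β̂` and the running-time
faithfulness test `α̂ < (u/2)|res|` (Langlois–Louvet 2007, §4)

HONEST FRAMING (ENGINES group, unit `eng-quad-4`, kernels lane of the `certquad` engine): shared
numerical engines serving client cells; rigour lives in the verifiers; every published number
belongs to a client cell's ledger, not to the engines group. The kernels' device trust bound is a
RUNNING (a posteriori) error bound evaluated in the SAME floating-point arithmetic as the result it
certifies; this file types and proves, in the MODEL / TRACE form of `CompHorner.lean` (rounding
errors are HYPOTHESES on a trace, discharged per format elsewhere), the published prototype of such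
a self-validating bound for polynomial evaluation: [LangloisLouvet2006, §4] (arXiv:cs/0610122 =
ARITH-18 2007, same numbering; equation numbers are those of the ARITH-18 print) — precisely the
items the module docstring of `CompHorner.lean` lists as NOT THERE (`γ̂ₖ`, eq. (5), the second
display of Lemma 1, `α̂`, `β̂`). No hardware, vendor, timing or format claims.

THE TWO FORMS OF THE STANDARD MODEL. [LangloisLouvet2006, §1.2 eq. (1)] states, for round-to-
nearest, BOTH `fl(a ∘ b) = (a ∘ b)(1 + ε₁)` AND `fl(a ∘ b) = (a ∘ b)/(1 + ε₂)`, `|ε₁|, |ε₂| ≤ u`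
(also [Higham2002ASNA, §2.2 eqs. (2.4)–(2.5)]). `Horner.lean` / `CompHorner.lean` use the first
form. The COMPUTABLE bounds of §1.2 and §4 need the second form — it is what produces the printed
constants `(1 + u)^k` (the first form would give `(1 - u)^{-k}`) — so every operation of the
bound-computing part of Algorithm `CompHornerIsFaithful` (the run `b̂ = Horner(|p_π| ⊕ |p_σ|, |x|)`,
the division in `γ̂`, `⊗`, `⊘`, `⊕`) is a hypothesis of the shape
`exact value = computed value · (1 + ρ)`, `|ρ| ≤ u`, on a TRACE of named computed quantities, while
the correcting term `ĉ = Horner(p_π ⊕ p_σ, x)` keeps the first-form encoding `compHornerCorr` of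
`CompHorner.lean`. The print's remarks "`fl(k u) = k u ∈ 𝔽`" and "`k u < 1 ⇒ fl(1 - k u) = 1 - k u`"
(numerator and denominator of `γ̂ₖ`, of eq. (5), of `α̂` and of `β̂` are computed exactly) are
rendered by writing those sub-expressions exactly: only the divisions round.

DEGREE CONVENTION. `CompHorner.lean` indexes a degree-`n` polynomial by its `n + 1` coefficients and
the `EFTHorner` errors `πᵢ, σᵢ` by `i < n`. Lemma 8 and Theorem 9 need `n ≥ 1` (`γ̂₂ₙ₋₁`); to keep
truncated subtraction out of every statement they are stated for `p` of degree `n + 1`: the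
correcting polynomials have the `n + 1` coefficients `πᵢ + σᵢ`, `i ≤ n`, the print's `γ̂₂ₙ₋₁`
reads `γ̂₂ₙ₊₁`, its `1 - 2(n + 1)u` reads `1 - (2n + 4)u`, and `p(x) = Σ_{i ≤ n+1} aᵢ xⁱ`.

Typed and PROVED (ordered field `K`; `u ≥ 0`):
* `abs_le_one_add_mul_abs_of_eq_mul`, `nonneg_of_eq_mul_one_add`, `le_one_add_mul_of_eq_mul` —
  eq. (1), second form, as used below: `t = c(1 + ρ)`, `|ρ| ≤ u` ⇒ `|t| ≤ (1 + u)|c|`; with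
  `u < 1` and `t ≥ 0` also `c ≥ 0` and `t ≤ (1 + u) c`.
* `gamma_le_one_add_mul_gammaHat` — eq. (4): `γ̂ₖ = (k u) ⊘ (1 ⊖ k u)` satisfies `γ̂ₖ ≥ 0` and
  `γₖ ≤ (1 + u) γ̂ₖ`.
* `one_add_pow_mul_le_of_div_eq` — eq. (5): `t ≥ 0`, `(n + 1)u < 1` ⇒
  `(1 + u)ⁿ t ≤ fl(t / (1 - (n + 1)u))` (from `Higham2002.one_add_pow_mul_one_sub_le`,
  `(1 + u)^{n+1}(1 - (n + 1)u) ≤ 1`).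
* `sum_le_one_add_pow_mul_horner₂` (with `horner₂_trace_nonneg`) — LEMMA 1, second display,
  eq. (8)–(9): on NON-NEGATIVE data (`aᵢ + bᵢ ≥ 0`, `x ≥ 0`) the computed value bounds the exact
  one, `(p + q)(x) ≤ (1 + u)^{2n+1} Horner(p ⊕ q, x)`, and the computed value is `≥ 0`.
* `abs_compHornerCorr_sub_le_alphaHat` — LEMMA 8, eq. (17): `|ĉ - c| ≤ α̂`,
  `α̂ = (γ̂ ⊗ b̂) ⊘ (1 ⊖ (2n + 4) ⊗ u)`, by the printed chain
  `γ (p̃_π + p̃_σ)(|x|) ≤ (1+u)^{2n+1} γ b̂ ≤ (1+u)^{2n+2} γ̂ b̂ ≤ (1+u)^{2n+3} (γ̂ ⊗ b̂) ≤ α̂`.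
* `abs_compHorner_twoSum_sub_sum_le_betaHat` — THEOREM 9 second item, eq. (19): with the last
  addition performed as `[res, e] = TwoSum(s₀, ĉ)`, `|res - p(x)| ≤ β̂ = (α̂ ⊕ |e|) ⊘ (1 ⊖ 2u)`
  (eq. (18) of `CompHorner.lean`, Lemma 8, eq. (1), eq. (5)).
* `abs_compHornerCorr_sub_lt_of_alphaHat_lt` — THEOREM 9 first item, its real-arithmetic core: the
  running-time test `α̂ < (u/2)|res|` (flag `isfaithful` of Algorithm `CompHornerIsFaithful`)
  gives `|ĉ - c| < (u/2)|res|`, the hypothesis of [LangloisLouvet2006, §3.2 Lemma 6].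

NOT HERE: the conclusion "`res` is a FAITHFUL ROUNDING of `p(x)`" of Theorem 9 (i) / Lemma 6 (it is
Lemma 5 = Rump–Ogita–Oishi, a statement about the floating-point FORMAT, exactly as for Theorem 7
in `CompHorner.lean`); the format facts `k u ∈ 𝔽`, `1 - k u ∈ 𝔽`, exactness of `|·|`, absence of
underflow/overflow (they shape the hypotheses and are discharged per format); the experiments of §5.
-/

namespace Literature.ComputerArithmetic.LangloisLouvet2006

open Finset Literature.ComputerArithmetic.Higham2002

variable {K : Type*} [Field K] [LinearOrder K] [IsStrictOrderedRing K]

/-! ## Eq. (1), second form: `a ∘ b = fl(a ∘ b) · (1 + ε₂)`, `|ε₂| ≤ u` -/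

/-- Eq. (1), second form of the standard model, read on a trace as `t = c (1 + ρ)` (`t` the exact
value of the operation, `c` the computed one, `|ρ| ≤ u`): `|t| ≤ (1 + u) |c|`.
[cite: LangloisLouvet2006, §1.2 eq. (1)] [cite: Higham2002ASNA, §2.2 eq. (2.5)] -/
theorem abs_le_one_add_mul_abs_of_eq_mul {u t c ρ : K} (h : t = c * (1 + ρ)) (hρ : |ρ| ≤ u) :
    |t| ≤ (1 + u) * |c| := by
  have h1 : |1 + ρ| ≤ 1 + u := by
    have := abs_le.mp hρ
    rw [abs_le]
    constructor <;> linarith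
  rw [h, abs_mul, mul_comm (1 + u)]
  exact mul_le_mul_of_nonneg_left h1 (abs_nonneg _)

/-- Eq. (1), second form, signs: if `t = c (1 + ρ)`, `|ρ| ≤ u < 1` and the exact value `t ≥ 0`,
then the computed value `c ≥ 0`. [cite: LangloisLouvet2006, §1.2 eq. (1)] -/
theorem nonneg_of_eq_mul_one_add {u t c ρ : K} (hu1 : u < 1) (h : t = c * (1 + ρ))
    (hρ : |ρ| ≤ u) (ht : 0 ≤ t) : 0 ≤ c := by
  have hρ1 : 0 < 1 + ρ := by
    have := abs_le.mp hρ
    linarith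
  by_contra hc
  have : c * (1 + ρ) < 0 := mul_neg_of_neg_of_pos (not_le.mp hc) hρ1
  linarith

/-- Eq. (1), second form, one-sided: `t = c (1 + ρ)`, `|ρ| ≤ u`, `c ≥ 0` ⇒ `t ≤ (1 + u) c`.
[cite: LangloisLouvet2006, §1.2 eq. (1)] -/
theorem le_one_add_mul_of_eq_mul {u t c ρ : K} (h : t = c * (1 + ρ)) (hρ : |ρ| ≤ u)
    (hc : 0 ≤ c) : t ≤ (1 + u) * c := by
  have h1 := abs_le_one_add_mul_abs_of_eq_mul h hρ
  rw [abs_of_nonneg hc] at h1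
  exact le_trans (le_abs_self t) h1

/-! ## The computable bounds of §1.2: `γ̂ₖ` (eq. (4)) and eq. (5) -/

/-- Eq. (4) (rel. GammaK). `γ̂ₖ := fl(γₖ) = (k u) ⊘ (1 ⊖ k u)`; the print notes `fl(k u) = k u`
and, for `k u < 1`, `fl(1 - k u) = 1 - k u`, so ONLY THE DIVISION ROUNDS: on the trace,
`k u / (1 - k u) = γ̂ₖ (1 + ρ)`, `|ρ| ≤ u` (`u < 1`). Then `γ̂ₖ ≥ 0` and `γₖ ≤ (1 + u) γ̂ₖ`
(`γₖ = Higham2002.gamma u k`). [cite: LangloisLouvet2006, §1.2 eq. (4)] -/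
theorem gamma_le_one_add_mul_gammaHat {u : K} (hu : 0 ≤ u) (hu1 : u < 1) {k : ℕ}
    (hk : (k : K) * u < 1) {g ρ : K} (hg : (k : K) * u / (1 - (k : K) * u) = g * (1 + ρ))
    (hρ : |ρ| ≤ u) : 0 ≤ g ∧ gamma u k ≤ (1 + u) * g := by
  have hγ : gamma u k = g * (1 + ρ) := hg
  have hγ0 : 0 ≤ gamma u k := gamma_nonneg hu hk
  have hg0 : 0 ≤ g := nonneg_of_eq_mul_one_add hu1 hγ hρ hγ0
  exact ⟨hg0, le_one_add_mul_of_eq_mul hγ hρ hg0⟩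

/-- Eq. (5) (rel. CompBound). For `t ≥ 0` (in print `t = |x|`, `x ∈ 𝔽`) and `n ∈ ℕ` with
`(n + 1) u < 1`: `(1 + u)ⁿ t ≤ fl(t / (1 - (n + 1) u))`, where `(n + 1) u` and `1 - (n + 1) u`
are computed exactly and the division rounds, `t / (1 - (n + 1) u) = y (1 + ρ)`, `|ρ| ≤ u`.
Proof ("direct application of eq. (1)"): `y ≥ t / ((1 + u)(1 - (n + 1) u))` and
`(1 + u)^{n+1} (1 - (n + 1) u) ≤ 1` (`Higham2002.one_add_pow_mul_one_sub_le`).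
[cite: LangloisLouvet2006, §1.2 eq. (5)] -/
theorem one_add_pow_mul_le_of_div_eq {u : K} (hu : 0 ≤ u) {n : ℕ}
    (hn : ((n + 1 : ℕ) : K) * u < 1) {t y ρ : K} (ht : 0 ≤ t)
    (hy : t / (1 - ((n + 1 : ℕ) : K) * u) = y * (1 + ρ)) (hρ : |ρ| ≤ u) :
    (1 + u) ^ n * t ≤ y := by
  have hρ' := abs_le.mp hρ
  have hcast : (1 : K) ≤ ((n + 1 : ℕ) : K) := by exact_mod_cast (by omega : 1 ≤ n + 1)
  have hu1 : u < 1 := by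
    have : u ≤ ((n + 1 : ℕ) : K) * u := le_mul_of_one_le_left hu hcast
    linarith
  have hd : 0 < 1 - ((n + 1 : ℕ) : K) * u := by linarith
  have hρ1 : 0 < 1 + ρ := by linarith
  have key : (1 + u) ^ (n + 1) * (1 - ((n + 1 : ℕ) : K) * u) ≤ 1 :=
    one_add_pow_mul_one_sub_le hu (n + 1)
  have ht' : t = y * (1 + ρ) * (1 - ((n + 1 : ℕ) : K) * u) := by
    rw [← hy, div_mul_cancel₀ _ hd.ne']
  have hpos : 0 < (1 + ρ) * (1 - ((n + 1 : ℕ) : K) * u) := mul_pos hρ1 hd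
  refine le_of_mul_le_mul_right ?_ hpos
  have hp : 0 ≤ (1 + u) ^ n * t := mul_nonneg (pow_nonneg (by linarith) _) ht
  calc (1 + u) ^ n * t * ((1 + ρ) * (1 - ((n + 1 : ℕ) : K) * u))
      = (1 + u) ^ n * t * (1 + ρ) * (1 - ((n + 1 : ℕ) : K) * u) := by ring
    _ ≤ (1 + u) ^ n * t * (1 + u) * (1 - ((n + 1 : ℕ) : K) * u) :=
        mul_le_mul_of_nonneg_right (mul_le_mul_of_nonneg_left (by linarith) hp) hd.le
    _ = (1 + u) ^ (n + 1) * (1 - ((n + 1 : ℕ) : K) * u) * t := by ring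
    _ ≤ 1 * t := mul_le_mul_of_nonneg_right key ht
    _ = y * ((1 + ρ) * (1 - ((n + 1 : ℕ) : K) * u)) := by rw [one_mul, ht']; ring

/-! ## Lemma 1, second display, eq. (8): on non-negative data the computed Horner value bounds
the exact one, `(p + q)(x) ≤ (1 + u)^{2n+1} Horner(p ⊕ q, x)` -/

/-- The trace of `Horner(p ⊕ q, x)` (Algorithm 1 applied to `p ⊕ q`, as in the proof of Lemma 1)
on NON-NEGATIVE data, in the second form of eq. (1): exact coefficient sums `fᵢ = aᵢ + bᵢ ≥ 0`
rounded to `wᵢ = aᵢ ⊕ bᵢ` (`fᵢ = wᵢ(1 + τᵢ)`, `i ≤ n`), `rₙ = wₙ`, and for `i < n` the products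
`vᵢ = rᵢ₊₁ ⊗ x` (`rᵢ₊₁ x = vᵢ(1 + εᵢ)`) and sums `rᵢ = vᵢ ⊕ wᵢ` (`vᵢ + wᵢ = rᵢ(1 + δᵢ)`), all
`|τᵢ|, |εᵢ|, |δᵢ| ≤ u < 1`, `x ≥ 0`. Then the computed value `r₀ ≥ 0`.
[cite: LangloisLouvet2006, §2.1 Lemma 1, proof of eq. (8)] -/
theorem horner₂_trace_nonneg {u : K} (hu1 : u < 1) {x : K} (hx : 0 ≤ x) :
    ∀ (n : ℕ) (f w r v τ ε δ : ℕ → K), (∀ i < n + 1, 0 ≤ f i) →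
      (∀ i < n + 1, f i = w i * (1 + τ i)) → r n = w n →
      (∀ i < n, r (i + 1) * x = v i * (1 + ε i)) → (∀ i < n, v i + w i = r i * (1 + δ i)) →
      (∀ k, |τ k| ≤ u) → (∀ k, |ε k| ≤ u) → (∀ k, |δ k| ≤ u) → 0 ≤ r 0
  | 0, f, w, r, v, τ, ε, δ, hf, hfw, hrn, _, _, hτ, _, _ => by
      rw [hrn]
      exact nonneg_of_eq_mul_one_add hu1 (hfw 0 (by omega)) (hτ 0) (hf 0 (by omega))
  | n + 1, f, w, r, v, τ, ε, δ, hf, hfw, hrn, hrx, hrs, hτ, hε, hδ => by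
      have ih := horner₂_trace_nonneg hu1 hx n (fun i => f (i + 1)) (fun i => w (i + 1))
        (fun i => r (i + 1)) (fun i => v (i + 1)) (fun i => τ (i + 1)) (fun i => ε (i + 1))
        (fun i => δ (i + 1)) (fun i hi => hf (i + 1) (by omega))
        (fun i hi => hfw (i + 1) (by omega)) hrn (fun i hi => hrx (i + 1) (by omega))
        (fun i hi => hrs (i + 1) (by omega)) (fun k => hτ (k + 1)) (fun k => hε (k + 1))
        (fun k => hδ (k + 1))
      beta_reduce at ih
      have hw0 : 0 ≤ w 0 :=
        nonneg_of_eq_mul_one_add hu1 (hfw 0 (by omega)) (hτ 0) (hf 0 (by omega))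
      have h0x : r (0 + 1) * x = v 0 * (1 + ε 0) := hrx 0 (by omega)
      simp only [zero_add] at h0x
      have hv0 : 0 ≤ v 0 := nonneg_of_eq_mul_one_add hu1 h0x (hε 0) (mul_nonneg ih hx)
      exact nonneg_of_eq_mul_one_add hu1 (hrs 0 (by omega)) (hδ 0) (add_nonneg hv0 hw0)

/-- LEMMA 1, second display, eq. (8) (model / trace form). `Horner(p ⊕ q, x)` on NON-NEGATIVE data
— exact coefficient sums `fᵢ = aᵢ + bᵢ ≥ 0` (`i ≤ n`), `x ≥ 0` — with the trace of Algorithm 1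
in the second form of eq. (1) as in `horner₂_trace_nonneg` (`fᵢ = wᵢ(1 + τᵢ)`, `rₙ = wₙ`,
`rᵢ₊₁ x = vᵢ(1 + εᵢ)`, `vᵢ + wᵢ = rᵢ(1 + δᵢ)`, `|τᵢ|, |εᵢ|, |δᵢ| ≤ u < 1`):
`(p + q)(x) = Σ_{i ≤ n} fᵢ xⁱ ≤ (1 + u)^{2n+1} r₀ = (1 + u)^{2n+1} Horner(p ⊕ q, x)`.
The print's induction eq. (9), `Σ_{j ≤ i} f_{n-i+j} xʲ ≤ (1 + u)^{2i+1} r_{n-i}`, is run on the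
shifted trace (peel off the last Horner step `i = 0`, `Higham2002.sum_mul_pow_succ_eq`).
[cite: LangloisLouvet2006, §2.1 Lemma 1 eq. (8)–(9)] -/
theorem sum_le_one_add_pow_mul_horner₂ {u : K} (hu : 0 ≤ u) (hu1 : u < 1) {x : K} (hx : 0 ≤ x) :
    ∀ (n : ℕ) (f w r v τ ε δ : ℕ → K), (∀ i < n + 1, 0 ≤ f i) →
      (∀ i < n + 1, f i = w i * (1 + τ i)) → r n = w n →
      (∀ i < n, r (i + 1) * x = v i * (1 + ε i)) → (∀ i < n, v i + w i = r i * (1 + δ i)) →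
      (∀ k, |τ k| ≤ u) → (∀ k, |ε k| ≤ u) → (∀ k, |δ k| ≤ u) →
      ∑ i ∈ range (n + 1), f i * x ^ i ≤ (1 + u) ^ (2 * n + 1) * r 0
  | 0, f, w, r, v, τ, ε, δ, hf, hfw, hrn, _, _, hτ, _, _ => by
      have hw0 : 0 ≤ w 0 :=
        nonneg_of_eq_mul_one_add hu1 (hfw 0 (by omega)) (hτ 0) (hf 0 (by omega))
      have h := le_one_add_mul_of_eq_mul (hfw 0 (by omega)) (hτ 0) hw0
      simpa [hrn] using h
  | n + 1, f, w, r, v, τ, ε, δ, hf, hfw, hrn, hrx, hrs, hτ, hε, hδ => by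
      have ih := sum_le_one_add_pow_mul_horner₂ hu hu1 hx n (fun i => f (i + 1))
        (fun i => w (i + 1)) (fun i => r (i + 1)) (fun i => v (i + 1)) (fun i => τ (i + 1))
        (fun i => ε (i + 1)) (fun i => δ (i + 1)) (fun i hi => hf (i + 1) (by omega))
        (fun i hi => hfw (i + 1) (by omega)) hrn (fun i hi => hrx (i + 1) (by omega))
        (fun i hi => hrs (i + 1) (by omega)) (fun k => hτ (k + 1)) (fun k => hε (k + 1))
        (fun k => hδ (k + 1))
      have hr1 := horner₂_trace_nonneg hu1 hx n (fun i => f (i + 1)) (fun i => w (i + 1))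
        (fun i => r (i + 1)) (fun i => v (i + 1)) (fun i => τ (i + 1)) (fun i => ε (i + 1))
        (fun i => δ (i + 1)) (fun i hi => hf (i + 1) (by omega))
        (fun i hi => hfw (i + 1) (by omega)) hrn (fun i hi => hrx (i + 1) (by omega))
        (fun i hi => hrs (i + 1) (by omega)) (fun k => hτ (k + 1)) (fun k => hε (k + 1))
        (fun k => hδ (k + 1))
      beta_reduce at ih hr1
      have hw0 : 0 ≤ w 0 :=
        nonneg_of_eq_mul_one_add hu1 (hfw 0 (by omega)) (hτ 0) (hf 0 (by omega))
      have h0x : r (0 + 1) * x = v 0 * (1 + ε 0) := hrx 0 (by omega)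
      simp only [zero_add] at h0x
      have hv0 : 0 ≤ v 0 := nonneg_of_eq_mul_one_add hu1 h0x (hε 0) (mul_nonneg hr1 hx)
      have hr0 : 0 ≤ r 0 :=
        nonneg_of_eq_mul_one_add hu1 (hrs 0 (by omega)) (hδ 0) (add_nonneg hv0 hw0)
      have hf0 : f 0 ≤ (1 + u) * w 0 := le_one_add_mul_of_eq_mul (hfw 0 (by omega)) (hτ 0) hw0
      have hrx0 : r 1 * x ≤ (1 + u) * v 0 := le_one_add_mul_of_eq_mul h0x (hε 0) hv0
      have hvw : v 0 + w 0 ≤ (1 + u) * r 0 :=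
        le_one_add_mul_of_eq_mul (hrs 0 (by omega)) (hδ 0) hr0
      have hP : 0 ≤ (1 + u) ^ (2 * n + 1) := pow_nonneg (by linarith) _
      have hge1 : 1 + u ≤ (1 + u) ^ (2 * n + 2) := by
        have h1 : (1 : K) ≤ (1 + u) ^ (2 * n + 1) := one_le_pow₀ (by linarith)
        calc 1 + u = (1 + u) * 1 := by ring
          _ ≤ (1 + u) * (1 + u) ^ (2 * n + 1) := mul_le_mul_of_nonneg_left h1 (by linarith)
          _ = (1 + u) ^ (2 * n + 2) := by ring
      rw [sum_mul_pow_succ_eq f x n]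
      calc (∑ i ∈ range (n + 1), f (i + 1) * x ^ i) * x + f 0
          ≤ (1 + u) ^ (2 * n + 1) * r 1 * x + (1 + u) * w 0 :=
            add_le_add (mul_le_mul_of_nonneg_right ih hx) hf0
        _ = (1 + u) ^ (2 * n + 1) * (r 1 * x) + (1 + u) * w 0 := by ring
        _ ≤ (1 + u) ^ (2 * n + 1) * ((1 + u) * v 0) + (1 + u) ^ (2 * n + 2) * w 0 :=
            add_le_add (mul_le_mul_of_nonneg_left hrx0 hP) (mul_le_mul_of_nonneg_right hge1 hw0)
        _ = (1 + u) ^ (2 * n + 2) * (v 0 + w 0) := by ring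
        _ ≤ (1 + u) ^ (2 * n + 2) * ((1 + u) * r 0) :=
            mul_le_mul_of_nonneg_left hvw (pow_nonneg (by linarith) _)
        _ = (1 + u) ^ (2 * (n + 1) + 1) * r 0 := by ring

/-! ## Lemma 8: the validated bound `α̂` on the error of the computed correcting term -/

/-- LEMMA 8, eq. (17) (model / trace form), for `p` of degree `n + 1` (DEGREE CONVENTION of the
module docstring: the correcting polynomials `p_π`, `p_σ` have the `n + 1` coefficients `πᵢ`, `σᵢ`,
`i ≤ n`; the print's `γ̂₂ₙ₋₁`, `1 - 2(n + 1)u` read `γ̂₂ₙ₊₁`, `1 - (2n + 4)u`). HYPOTHESES: the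
roundings `|τᵢ|, |εᵢ|, |δᵢ| ≤ u` of `ĉ = Horner(p_π ⊕ p_σ, x)` (first form, `compHornerCorr`); the
trace of `b̂ = Horner(|p_π| ⊕ |p_σ|, |x|)` in the second form (`|πᵢ| + |σᵢ| = wᵢ(1 + τ'ᵢ)`,
`rₙ = wₙ`, `rᵢ₊₁ |x| = vᵢ(1 + ε'ᵢ)`, `vᵢ + wᵢ = rᵢ(1 + δ'ᵢ)`; `b̂ = r₀`); `γ̂ = γ̂₂ₙ₊₁` by
eq. (4) (`(2n + 1)u / (1 - (2n + 1)u) = γ̂(1 + ρ₁)`); the product `μ = γ̂ ⊗ b̂`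
(`γ̂ r₀ = μ(1 + ρ₂)`); the quotient `α̂ = μ ⊘ (1 ⊖ (2n + 4) ⊗ u)` with exact denominator
(`μ / (1 - (2n + 4)u) = α̂(1 + ρ₃)`); `|ρ₁|, |ρ₂|, |ρ₃|, |τ'ᵢ|, |ε'ᵢ|, |δ'ᵢ| ≤ u`;
`(2n + 4)u < 1`. CONCLUSION: `|ĉ - c| ≤ α̂` for `c = (p_π + p_σ)(x) = Σ_{i ≤ n} (πᵢ + σᵢ) xⁱ`.
Proof as printed: eq. (7) (`abs_hornerFl_perturbed_sub_sum_le_gamma`), eq. (8), eq. (4), eq. (1),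
eq. (5): `|ĉ - c| ≤ γ₂ₙ₊₁ (p̃_π + p̃_σ)(|x|) ≤ (1 + u)^{2n+1} γ₂ₙ₊₁ b̂ ≤ (1 + u)^{2n+2} γ̂ b̂
≤ (1 + u)^{2n+3} μ ≤ α̂`. [cite: LangloisLouvet2006, §4 Lemma 8 eq. (17)] -/
theorem abs_compHornerCorr_sub_le_alphaHat {u : K} (hu : 0 ≤ u) {n : ℕ}
    (hn : ((2 * n + 4 : ℕ) : K) * u < 1) (x : K) (π σ τ ε δ : ℕ → K)
    (hτ : ∀ k, |τ k| ≤ u) (hε : ∀ k, |ε k| ≤ u) (hδ : ∀ k, |δ k| ≤ u)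
    (w r v τ' ε' δ' : ℕ → K) (hw : ∀ i < n + 1, |π i| + |σ i| = w i * (1 + τ' i))
    (hrn : r n = w n) (hrx : ∀ i < n, r (i + 1) * |x| = v i * (1 + ε' i))
    (hrs : ∀ i < n, v i + w i = r i * (1 + δ' i))
    (hτ' : ∀ k, |τ' k| ≤ u) (hε' : ∀ k, |ε' k| ≤ u) (hδ' : ∀ k, |δ' k| ≤ u)
    {g μ α ρ₁ ρ₂ ρ₃ : K}
    (hg : ((2 * n + 1 : ℕ) : K) * u / (1 - ((2 * n + 1 : ℕ) : K) * u) = g * (1 + ρ₁))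
    (hμ : g * r 0 = μ * (1 + ρ₂))
    (hα : μ / (1 - ((2 * n + 4 : ℕ) : K) * u) = α * (1 + ρ₃))
    (hρ₁ : |ρ₁| ≤ u) (hρ₂ : |ρ₂| ≤ u) (hρ₃ : |ρ₃| ≤ u) :
    |compHornerCorr x π σ τ ε δ (n + 1) - ∑ i ∈ range (n + 1), (π i + σ i) * x ^ i| ≤ α := by
  have hc1 : ((2 * n + 1 : ℕ) : K) ≤ ((2 * n + 4 : ℕ) : K) := by
    exact_mod_cast (by omega : 2 * n + 1 ≤ 2 * n + 4)
  have hc2 : (1 : K) ≤ ((2 * n + 4 : ℕ) : K) := by exact_mod_cast (by omega : 1 ≤ 2 * n + 4)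
  have hn1 : ((2 * n + 1 : ℕ) : K) * u < 1 := by
    have := mul_le_mul_of_nonneg_right hc1 hu
    linarith
  have hu1 : u < 1 := by
    have : u ≤ ((2 * n + 4 : ℕ) : K) * u := le_mul_of_one_le_left hu hc2
    linarith
  have hx : 0 ≤ |x| := abs_nonneg x
  -- eq. (7): Lemma 1 on the `n + 1` coefficients of `p_π ⊕ p_σ`
  have hcorr : compHornerCorr x π σ τ ε δ (n + 1)
      = hornerFl x (fun i => (π i + σ i) * (1 + τ i)) ε δ n := by
    simp only [compHornerCorr, hornerFlTrunc]
  have h7 : |compHornerCorr x π σ τ ε δ (n + 1) - ∑ i ∈ range (n + 1), (π i + σ i) * x ^ i|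
      ≤ gamma u (2 * n + 1) * ∑ i ∈ range (n + 1), |π i + σ i| * |x| ^ i := by
    rw [hcorr]
    exact abs_hornerFl_perturbed_sub_sum_le_gamma hu hn1 x (fun i => π i + σ i) τ ε δ hτ hε hδ
  -- `(p_π + p_σ)~(|x|) ≤ (p̃_π + p̃_σ)(|x|)` coefficientwise
  have hS : ∑ i ∈ range (n + 1), |π i + σ i| * |x| ^ i
      ≤ ∑ i ∈ range (n + 1), (|π i| + |σ i|) * |x| ^ i :=
    Finset.sum_le_sum fun i _ => mul_le_mul_of_nonneg_right (abs_add_le _ _) (by positivity)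
  -- eq. (8): `(p̃_π + p̃_σ)(|x|) ≤ (1 + u)^{2n+1} b̂`, and `b̂ ≥ 0`
  have h8 : ∑ i ∈ range (n + 1), (|π i| + |σ i|) * |x| ^ i ≤ (1 + u) ^ (2 * n + 1) * r 0 :=
    sum_le_one_add_pow_mul_horner₂ hu hu1 hx n (fun i => |π i| + |σ i|) w r v τ' ε' δ'
      (fun i _ => add_nonneg (abs_nonneg _) (abs_nonneg _)) hw hrn hrx hrs hτ' hε' hδ'
  have hr0 : 0 ≤ r 0 :=
    horner₂_trace_nonneg hu1 hx n (fun i => |π i| + |σ i|) w r v τ' ε' δ'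
      (fun i _ => add_nonneg (abs_nonneg _) (abs_nonneg _)) hw hrn hrx hrs hτ' hε' hδ'
  -- eq. (4): `γ ≤ (1 + u) γ̂`, `γ̂ ≥ 0`
  obtain ⟨hg0, hγ⟩ := gamma_le_one_add_mul_gammaHat hu hu1 hn1 hg hρ₁
  have hγ0 : 0 ≤ gamma u (2 * n + 1) := gamma_nonneg hu hn1
  -- eq. (1) for the product `μ = γ̂ ⊗ b̂`
  have hμ0 : 0 ≤ μ := nonneg_of_eq_mul_one_add hu1 hμ hρ₂ (mul_nonneg hg0 hr0)
  have hgr : g * r 0 ≤ (1 + u) * μ := le_one_add_mul_of_eq_mul hμ hρ₂ hμ0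
  -- eq. (5) with exponent `2n + 3`
  have hn' : ((2 * n + 3 + 1 : ℕ) : K) * u < 1 := hn
  have hα' : μ / (1 - ((2 * n + 3 + 1 : ℕ) : K) * u) = α * (1 + ρ₃) := hα
  have h5 : (1 + u) ^ (2 * n + 3) * μ ≤ α := one_add_pow_mul_le_of_div_eq hu hn' hμ0 hα' hρ₃
  have hM : 0 ≤ (1 + u) ^ (2 * n + 1) * r 0 := mul_nonneg (pow_nonneg (by linarith) _) hr0
  calc |compHornerCorr x π σ τ ε δ (n + 1) - ∑ i ∈ range (n + 1), (π i + σ i) * x ^ i|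
      ≤ gamma u (2 * n + 1) * ∑ i ∈ range (n + 1), |π i + σ i| * |x| ^ i := h7
    _ ≤ gamma u (2 * n + 1) * ((1 + u) ^ (2 * n + 1) * r 0) :=
        mul_le_mul_of_nonneg_left (le_trans hS h8) hγ0
    _ ≤ (1 + u) * g * ((1 + u) ^ (2 * n + 1) * r 0) := mul_le_mul_of_nonneg_right hγ hM
    _ = (1 + u) ^ (2 * n + 2) * (g * r 0) := by ring
    _ ≤ (1 + u) ^ (2 * n + 2) * ((1 + u) * μ) :=
        mul_le_mul_of_nonneg_left hgr (pow_nonneg (by linarith) _)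
    _ = (1 + u) ^ (2 * n + 3) * μ := by ring
    _ ≤ α := h5

/-! ## Theorem 9: the validated running error bound `β̂` and the dynamic faithfulness test -/

/-- THEOREM 9, second item, eq. (19) (model / trace form; `p` of degree `n + 1`, notation and
hypotheses of Lemma 8 = `abs_compHornerCorr_sub_le_alphaHat`). Along the `EFTHorner` trace
(`sₙ₊₁ = aₙ₊₁`; `sᵢ₊₁ x = pᵢ + πᵢ`, `pᵢ + aᵢ = sᵢ + σᵢ` for `i ≤ n`), with the final addition
performed as `[res, e] = TwoSum(s₀, ĉ)` (`res + e = s₀ + ĉ` exactly; `|e|` is exact),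
`φ = α̂ ⊕ |e|` (`α̂ + |e| = φ(1 + ρ₄)`) and `β̂ = φ ⊘ (1 ⊖ 2u)` with exact denominator
(`φ / (1 - 2u) = β̂(1 + ρ₅)`), `|ρ₄|, |ρ₅| ≤ u`: `|res - p(x)| ≤ β̂`, `p(x) = Σ_{i ≤ n+1} aᵢ xⁱ`.
Proof as printed: eq. (18) (`abs_res_sub_sum_le_of_twoSum`) `|res - p(x)| ≤ |ĉ - c| + |e|`,
`≤ α̂ + |e|` (Lemma 8), `≤ (1 + u) φ` (eq. (1)), `≤ β̂` (eq. (5) with exponent `1`).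
[cite: LangloisLouvet2006, §4 Theorem 9 eq. (19)] -/
theorem abs_compHorner_twoSum_sub_sum_le_betaHat {u : K} (hu : 0 ≤ u) {n : ℕ}
    (hn : ((2 * n + 4 : ℕ) : K) * u < 1) (x : K) (a s p π σ τ ε δ : ℕ → K)
    (hsn : s (n + 1) = a (n + 1)) (hprod : ∀ i < n + 1, s (i + 1) * x = p i + π i)
    (hsum : ∀ i < n + 1, p i + a i = s i + σ i)
    (hτ : ∀ k, |τ k| ≤ u) (hε : ∀ k, |ε k| ≤ u) (hδ : ∀ k, |δ k| ≤ u)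
    (w r v τ' ε' δ' : ℕ → K) (hw : ∀ i < n + 1, |π i| + |σ i| = w i * (1 + τ' i))
    (hrn : r n = w n) (hrx : ∀ i < n, r (i + 1) * |x| = v i * (1 + ε' i))
    (hrs : ∀ i < n, v i + w i = r i * (1 + δ' i))
    (hτ' : ∀ k, |τ' k| ≤ u) (hε' : ∀ k, |ε' k| ≤ u) (hδ' : ∀ k, |δ' k| ≤ u)
    {g μ α ρ₁ ρ₂ ρ₃ : K}
    (hg : ((2 * n + 1 : ℕ) : K) * u / (1 - ((2 * n + 1 : ℕ) : K) * u) = g * (1 + ρ₁))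
    (hμ : g * r 0 = μ * (1 + ρ₂))
    (hα : μ / (1 - ((2 * n + 4 : ℕ) : K) * u) = α * (1 + ρ₃))
    (hρ₁ : |ρ₁| ≤ u) (hρ₂ : |ρ₂| ≤ u) (hρ₃ : |ρ₃| ≤ u)
    {res e φ β ρ₄ ρ₅ : K} (hres : res + e = s 0 + compHornerCorr x π σ τ ε δ (n + 1))
    (hφ : α + |e| = φ * (1 + ρ₄)) (hβ : φ / (1 - 2 * u) = β * (1 + ρ₅))
    (hρ₄ : |ρ₄| ≤ u) (hρ₅ : |ρ₅| ≤ u) :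
    |res - ∑ i ∈ range (n + 2), a i * x ^ i| ≤ β := by
  have hc2 : (2 : K) ≤ ((2 * n + 4 : ℕ) : K) := by exact_mod_cast (by omega : 2 ≤ 2 * n + 4)
  have hu2 : 2 * u < 1 := by
    have := mul_le_mul_of_nonneg_right hc2 hu
    linarith
  have hu1 : u < 1 := by linarith
  have h18 := abs_res_sub_sum_le_of_twoSum x (n + 1) a s p π σ
    (compHornerCorr x π σ τ ε δ (n + 1)) res e hsn hprod hsum hres
  have h17 := abs_compHornerCorr_sub_le_alphaHat hu hn x π σ τ ε δ hτ hε hδ w r v τ' ε' δ' hw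
    hrn hrx hrs hτ' hε' hδ' hg hμ hα hρ₁ hρ₂ hρ₃
  have hφarg : 0 ≤ α + |e| := add_nonneg (le_trans (abs_nonneg _) h17) (abs_nonneg e)
  have hφ0 : 0 ≤ φ := nonneg_of_eq_mul_one_add hu1 hφ hρ₄ hφarg
  have hφ1 : α + |e| ≤ (1 + u) * φ := le_one_add_mul_of_eq_mul hφ hρ₄ hφ0
  have hn2 : ((0 + 1 + 1 : ℕ) : K) * u < 1 := by
    rw [show ((0 + 1 + 1 : ℕ) : K) = 2 by norm_num]
    exact hu2
  have hβ' : φ / (1 - ((0 + 1 + 1 : ℕ) : K) * u) = β * (1 + ρ₅) := by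
    rw [show ((0 + 1 + 1 : ℕ) : K) = 2 by norm_num]
    exact hβ
  have h5 : (1 + u) ^ (0 + 1) * φ ≤ β := one_add_pow_mul_le_of_div_eq hu hn2 hφ0 hβ' hρ₅
  rw [zero_add, pow_one] at h5
  calc |res - ∑ i ∈ range (n + 2), a i * x ^ i|
      ≤ |compHornerCorr x π σ τ ε δ (n + 1) - ∑ i ∈ range (n + 1), (π i + σ i) * x ^ i| + |e| :=
        h18
    _ ≤ α + |e| := add_le_add h17 le_rfl
    _ ≤ (1 + u) * φ := hφ1
    _ ≤ β := h5

/-- THEOREM 9, first item — its real-arithmetic core (model / trace form, hypotheses of Lemma 8).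
The RUNNING-TIME TEST `α̂ < (u/2)|res|` (the flag `isfaithful` of Algorithm `CompHornerIsFaithful`)
gives `|ĉ - c| < (u/2)|res|`, which is the hypothesis of [LangloisLouvet2006, §3.2 Lemma 6]; the
conclusion "`res = s₀ ⊕ ĉ` is a FAITHFUL ROUNDING of `p(x)`" is Lemma 5 (Rump–Ogita–Oishi), a
statement about the floating-point FORMAT, NOT made here (as for Theorem 7 in `CompHorner.lean`).
`res` is unconstrained in this inequality. [cite: LangloisLouvet2006, §4 Theorem 9] -/
theorem abs_compHornerCorr_sub_lt_of_alphaHat_lt {u : K} (hu : 0 ≤ u) {n : ℕ}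
    (hn : ((2 * n + 4 : ℕ) : K) * u < 1) (x : K) (π σ τ ε δ : ℕ → K)
    (hτ : ∀ k, |τ k| ≤ u) (hε : ∀ k, |ε k| ≤ u) (hδ : ∀ k, |δ k| ≤ u)
    (w r v τ' ε' δ' : ℕ → K) (hw : ∀ i < n + 1, |π i| + |σ i| = w i * (1 + τ' i))
    (hrn : r n = w n) (hrx : ∀ i < n, r (i + 1) * |x| = v i * (1 + ε' i))
    (hrs : ∀ i < n, v i + w i = r i * (1 + δ' i))
    (hτ' : ∀ k, |τ' k| ≤ u) (hε' : ∀ k, |ε' k| ≤ u) (hδ' : ∀ k, |δ' k| ≤ u)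
    {g μ α ρ₁ ρ₂ ρ₃ : K}
    (hg : ((2 * n + 1 : ℕ) : K) * u / (1 - ((2 * n + 1 : ℕ) : K) * u) = g * (1 + ρ₁))
    (hμ : g * r 0 = μ * (1 + ρ₂))
    (hα : μ / (1 - ((2 * n + 4 : ℕ) : K) * u) = α * (1 + ρ₃))
    (hρ₁ : |ρ₁| ≤ u) (hρ₂ : |ρ₂| ≤ u) (hρ₃ : |ρ₃| ≤ u) (res : K) (htest : α < u / 2 * |res|) :
    |compHornerCorr x π σ τ ε δ (n + 1) - ∑ i ∈ range (n + 1), (π i + σ i) * x ^ i|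
      < u / 2 * |res| :=
  lt_of_le_of_lt (abs_compHornerCorr_sub_le_alphaHat hu hn x π σ τ ε δ hτ hε hδ w r v τ' ε' δ' hw
    hrn hrx hrs hτ' hε' hδ' hg hμ hα hρ₁ hρ₂ hρ₃) htest

end Literature.ComputerArithmetic.LangloisLouvet2006
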